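import Summits.Parity.BatemanHorn.Theorems.RoughValueTransportDefs
import Summits.Parity.BatemanHorn.Theorems.BalancedSemiprimeLayer.Negative.Strengthenings
import Summits.Parity.BatemanHorn.Theorems.BalancedSemiprimeLayer.Negative.FalseWithoutNotAssociated
import Summits.Parity.BatemanHorn.Theorems.BalancedSemiprimeLayer.Negative.FalseWithoutNoFixedPrimeDivisor

/-!
# `BalancedSemiprimeLayer` (crux stmt-Parity-9469), line `smooth-modulus-twisted-hooley`:
# the stub `stub_linearLayer` needs `pairwise_not_associated` and `hasNoFixedPrimeDivisor`

Negative-side load-bearing analysis at STUB level (drefute gen 2, refuter-drefute-stmt-Parity-9469-g2-0),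
PROVED. The registered stub

  `stub_linearLayer : ∀ k f, IsBatemanHornSystem f → ∀ i, (f i).natDegree = 1 → CoordLayerThin f i`

(vocabulary `coordLayer` / `CoordLayerThin` of `Theorems/RoughValueTransportDefs.lean`) becomes FALSE when
either of two hypotheses of `IsBatemanHornSystem` is dropped:

* `not_coordLayerThin_X_X` / `stub_linearLayer_false_without_notAssociated` — witness the duplicated
  system `(X, X)`, coordinate `0`: its layer `E_{(X,X),0}(x, δ)` contains every `x^{(1−δ)/2}`-rough
  non-prime `n ≤ x`, i.e. at least `Φ(x, x^{(1−δ)/2}) − π(x) ∼ log((1+δ)/(1−δ))·x/log x`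
  (`tendsto_layer_X`), against the `k = 2` tolerance `ε·x/(log x)²`;
* `not_coordLayerThin_two_X` / `stub_linearLayer_false_without_noFixedPrimeDivisor` — witness `(2, X)`,
  coordinate `1` (the linear one): the prime constant `2` has degree `0`, its sifting range
  `p < x^{0·(1−δ)/2} = 1` is empty, so the joint roughness is the roughness of `n` alone and the layer is
  again `≥ Φ(x, x^{(1−δ)/2}) − π(x)`.

So any proof of `stub_linearLayer` must use both hypotheses (the first is the source of the `k`
logarithms — distinct coordinates sift independently; the second only excludes prime constants, exactly
as for the crux itself: `balancedSemiprimeLayer_false_without_noFixedPrimeDivisor`, `Decoration.lean`).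
`irreducible` and `leadingCoeff_pos` are not exercised by these witnesses.
-/

namespace Summit.Parity.BatemanHorn.Theorems.BalancedSemiprimeLayer.Negative

open Filter Finset Polynomial Real
open scoped Topology
open Literature.NumberTheory.Sieve
open Summit.Parity.BatemanHorn.Cruxes.BalancedSemiprimeLayer.SmoothModulusTwistedHooley
  (coordLayer CoordLayerThin)

/-- From "the layer finset of coordinate `i` contains every rough non-prime `n ∈ [1, x]`" (for all
`δ, x`) to `¬ CoordLayerThin f i` when `k = 2`: the `(X)`-layer `Φ(x, x^{(1−δ)/2}) − π(x)` beats
`ε·x/(log x)²`. [folklore] -/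
theorem not_coordLayerThin_of_roughIcc_sub {f : Fin 2 → ℤ[X]} {i : Fin 2}
    (hS : ∀ (δ : ℝ) (x : ℕ), ∀ n ∈ roughIcc ⌈(x : ℝ) ^ ((1 - δ) / 2)⌉₊ x, ¬ n.Prime →
      n ∈ (Icc 1 x).filter (fun n : ℕ => (∀ j, 0 < (f j).eval (n : ℤ) ∧
        ∀ p ∈ range ⌈(x : ℝ) ^ (((f j).natDegree : ℝ) * (1 - δ) / 2)⌉₊,
          p.Prime → ¬ ((p : ℤ) ∣ (f j).eval (n : ℤ))) ∧ ¬ ((f i).eval (n : ℤ)).toNat.Prime)) :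
    ¬ CoordLayerThin f i := by
  intro h
  obtain ⟨δ, hδ0, hδ, hev⟩ := h 1 one_pos
  have hgt := eventually_mul_div_log_pow_lt (tendsto_layer_X hδ0.le hδ)
    (log_ratio_pos hδ0 (by linarith)) 1 (le_refl 2)
  obtain ⟨x, h1, h2⟩ := (hev.and hgt).exists
  have h3 : #(roughIcc ⌈(x : ℝ) ^ ((1 - δ) / 2)⌉₊ x) ≤ coordLayer f i δ x + Nat.primeCounting x :=
    card_roughIcc_le_card_add_primeCounting (hS δ x)
  have h3' : (#(roughIcc ⌈(x : ℝ) ^ ((1 - δ) / 2)⌉₊ x) : ℝ) ≤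
      (coordLayer f i δ x : ℝ) + (Nat.primeCounting x : ℝ) := by
    exact_mod_cast h3
  linarith

/-- **The layer of coordinate `0` of the duplicated system `(X, X)` is NOT thin.** [folklore] -/
theorem not_coordLayerThin_X_X : ¬ CoordLayerThin ![(X : ℤ[X]), X] 0 := by
  refine not_coordLayerThin_of_roughIcc_sub fun δ x n hn hnp => ?_
  rw [mem_roughIcc] at hn
  simp only [mem_filter, mem_Icc, Fin.forall_fin_two, Matrix.cons_val_zero, Matrix.cons_val_one,
    eval_X, natDegree_X, Nat.cast_one, one_mul, Int.toNat_natCast, mem_range, and_self]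
  refine ⟨hn.1, ⟨by exact_mod_cast hn.1.1, fun p hp hpp hdvd => ?_⟩, hnp⟩
  exact absurd (hn.2 p hpp (Int.natCast_dvd_natCast.mp hdvd)) (not_le.mpr hp)

/-- **The layer of the linear coordinate `X` of the system `(2, X)` is NOT thin** (the prime constant
`2` is sifted by no prime: `x^{0·(1−δ)/2} = 1`). [folklore] -/
theorem not_coordLayerThin_two_X : ¬ CoordLayerThin ![C (2 : ℤ), (X : ℤ[X])] 1 := by
  refine not_coordLayerThin_of_roughIcc_sub fun δ x n hn hnp => ?_
  rw [mem_roughIcc] at hn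
  simp only [mem_filter, mem_Icc, Fin.forall_fin_two, Matrix.cons_val_zero, Matrix.cons_val_one,
    eval_X, natDegree_X, Nat.cast_one, one_mul, Int.toNat_natCast, mem_range, eval_C, natDegree_C,
    CharP.cast_eq_zero, zero_mul, zero_div, Real.rpow_zero, Nat.ceil_one]
  refine ⟨hn.1, ⟨⟨by norm_num, fun p hp hpp _ => ?_⟩, by exact_mod_cast hn.1.1,
    fun p hp hpp hdvd => ?_⟩, hnp⟩
  · exact absurd hpp (by interval_cases p; exact Nat.not_prime_zero)
  exact absurd (hn.2 p hpp (Int.natCast_dvd_natCast.mp hdvd)) (not_le.mpr hp)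

/-- **Any proof of `stub_linearLayer` must use `pairwise_not_associated`**: with that hypothesis of
`IsBatemanHornSystem` dropped the stub is false (witness `(X, X)`, coordinate `0`). [folklore] -/
theorem stub_linearLayer_false_without_notAssociated :
    ¬ ∀ (k : ℕ) (f : Fin k → ℤ[X]), (∀ i, Irreducible (f i)) → (∀ i, 0 < (f i).leadingCoeff) →
      HasNoFixedPrimeDivisor f → ∀ i : Fin k, (f i).natDegree = 1 → CoordLayerThin f i := by
  intro h
  have hirr : ∀ i, Irreducible (![(X : ℤ[X]), X] i) := by
    intro i; fin_cases i <;> exact irreducible_X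
  have hlc : ∀ i, 0 < (![(X : ℤ[X]), X] i).leadingCoeff := by
    intro i; fin_cases i <;> simp
  exact not_coordLayerThin_X_X (h 2 ![X, X] hirr hlc hasNoFixedPrimeDivisor_X_X 0 natDegree_X)

/-- **Any proof of `stub_linearLayer` must use `hasNoFixedPrimeDivisor`** (to exclude prime
constants): with that hypothesis dropped the stub is false (witness `(2, X)`, the linear coordinate
`1`). [folklore] -/
theorem stub_linearLayer_false_without_noFixedPrimeDivisor :
    ¬ ∀ (k : ℕ) (f : Fin k → ℤ[X]), (∀ i, Irreducible (f i)) → (∀ i, 0 < (f i).leadingCoeff) →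
      (Pairwise fun i j => ¬Associated (f i) (f j)) →
        ∀ i : Fin k, (f i).natDegree = 1 → CoordLayerThin f i := by
  intro h
  have hirr : ∀ i, Irreducible (![C (2 : ℤ), (X : ℤ[X])] i) := by
    intro i
    fin_cases i
    · exact irreducible_C_two
    · exact irreducible_X
  have hlc : ∀ i, 0 < (![C (2 : ℤ), (X : ℤ[X])] i).leadingCoeff := by
    intro i
    fin_cases i
    · show 0 < (C (2 : ℤ) : ℤ[X]).leadingCoeff
      rw [leadingCoeff_C]; norm_num
    · show 0 < (X : ℤ[X]).leadingCoeff
      rw [leadingCoeff_X]; norm_num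
  exact not_coordLayerThin_two_X
    (h 2 ![C (2 : ℤ), X] hirr hlc pairwise_not_associated_two_X 1 natDegree_X)

end Summit.Parity.BatemanHorn.Theorems.BalancedSemiprimeLayer.Negative
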